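import Mathlib.MeasureTheory.Integral.DominatedConvergence
import Mathlib.MeasureTheory.Integral.Bochner.Set
import Mathlib.Analysis.SpecificLimits.Basic
import HarnessLib

/-!
# The limit `r → ∞` in Brendle's ABP proof: `θ |Bⁿ| ≤ ∫_U κⁿ`

Topic `Geometry/Riemannian`. The last paragraph of S. Brendle's ABP proof of the sharp Sobolev
inequality on manifolds with `Ric ≥ 0` (*Sobolev inequalities in manifolds with nonnegative
curvature*, CPAM 76 (2023), §2, end of the proof of Thm. 1.1): having shown, for every large `r`,

  `|{p : d(x, p) < r for all x ∈ D}| ≤ ∫_U (1 + r f^{1/(n-1)})ⁿ dvol`,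

"we divide by `rⁿ` and send `r → ∞`", obtaining `|Bⁿ| θ ≤ ∫_U f^{n/(n-1)}` with `θ` the asymptotic
volume ratio. This file isolates that step as a statement about a measure `μ` on a set `X` with a
symmetric "distance" `d : X → X → [0, ∞]` satisfying the triangle inequality
(`volumeRatio_mul_le_setIntegral_pow_of_measure_le`): if
`μ{d(x₀, ·) ≤ r} / (ω rⁿ) → θ`, `K` is `d`-bounded, `U` has finite measure, `κ ≥ 0` with `κⁿ`
integrable on `U`, and eventually `μ{p : ∀ x ∈ K, d(x, p) < r} ≤ ∫_U (1 + r κ)ⁿ dμ`, then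
`θ ω ≤ ∫_U κⁿ dμ`. The proof is the printed one: the ball `{d(x₀, ·) ≤ r - R₀ - 1}` lies in the
set on the left, and `∫_U ((1 + rκ)/(r - R₀ - 1))ⁿ → ∫_U κⁿ` by dominated convergence.

Pure measure theory; no definitions, no named facts (a brick of the geometric half of the proof of
`Literature.Geometry.Riemannian.sharpLogSobolevAVR_four`, used with `n = 4`, `ω = π²/2`,
`κ = f^{1/3}`).

## References

* [Brendle2022] S. Brendle, CPAM 76 (2023) 2192–2218 (arXiv:2009.13717), §2, proof of Thm. 1.1,
  last paragraph (p. 7 of the arXiv text). READ.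
-/

noncomputable section

namespace Literature.Geometry.Riemannian

section ABPVolumeRatioLimit

open Set Filter Topology MeasureTheory ENNReal

/-- `max 1 κ ^ n ≤ 1 + κ ^ n` for `κ ≥ 0`, hence `(1 + κ)ⁿ ≤ 2ⁿ (1 + κⁿ)`. [folklore] -/
theorem one_add_pow_le_two_pow_mul {κ : ℝ} (hκ : 0 ≤ κ) (n : ℕ) :
    (1 + κ) ^ n ≤ 2 ^ n * (1 + κ ^ n) := by
  have h1 : 1 + κ ≤ 2 * max 1 κ := by
    have := le_max_left 1 κ; have := le_max_right 1 κ; linarith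
  have h2 : (max 1 κ) ^ n ≤ 1 + κ ^ n := by
    rcases le_total κ 1 with h | h
    · rw [max_eq_left h, one_pow]; linarith [pow_nonneg hκ n]
    · rw [max_eq_right h]; linarith
  calc (1 + κ) ^ n ≤ (2 * max 1 κ) ^ n := pow_le_pow_left₀ (by linarith) h1 n
    _ = 2 ^ n * (max 1 κ) ^ n := mul_pow _ _ _
    _ ≤ 2 ^ n * (1 + κ ^ n) := by gcongr

/-- `(1 + rκ)/(r - c) → κ` as `r → ∞`. [folklore] -/
theorem tendsto_one_add_mul_div_sub (κ c : ℝ) :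
    Tendsto (fun r : ℝ ↦ (1 + r * κ) / (r - c)) atTop (𝓝 κ) := by
  have h1 : Tendsto (fun r : ℝ ↦ r⁻¹) atTop (𝓝 0) := tendsto_inv_atTop_zero
  have hnum : Tendsto (fun r : ℝ ↦ r⁻¹ + κ) atTop (𝓝 κ) := by
    simpa using h1.add_const κ
  have hden : Tendsto (fun r : ℝ ↦ 1 - c * r⁻¹) atTop (𝓝 1) := by
    simpa using (h1.const_mul c).const_sub 1
  have h : Tendsto (fun r : ℝ ↦ (r⁻¹ + κ) / (1 - c * r⁻¹)) atTop (𝓝 κ) := by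
    have h0 := hnum.div hden one_ne_zero
    rw [div_one] at h0
    exact h0.congr fun r ↦ rfl
  refine h.congr' ?_
  filter_upwards [eventually_gt_atTop 0, eventually_gt_atTop c] with r hr hrc
  have hr0 : r ≠ 0 := hr.ne'
  have hrc0 : r - c ≠ 0 := sub_ne_zero.2 (ne_of_gt hrc)
  have h1c : 1 - c * r⁻¹ = (r - c) * r⁻¹ := by field_simp
  rw [h1c, div_eq_div_iff (mul_ne_zero hrc0 (inv_ne_zero hr0)) hrc0]
  field_simp

/-- **The limit `r → ∞` in the ABP argument (Brendle 2023, end of the proof of Thm. 1.1).** Let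
`μ` be a measure on `X`, `d : X → X → [0, ∞]` symmetric with the triangle inequality, and suppose
the volume ratio `μ{y : d(x₀, y) ≤ r} / (ω rⁿ)` tends to `θ` as `r → ∞` (`ω > 0`). Let `K` be
`d`-bounded (`d(x₀, x) ≤ R₀` on `K`), `U` of finite measure, `κ ≥ 0` a.e.-strongly measurable on
`U` with `κⁿ` integrable on `U`, and assume that for all large `r`,
`μ{p : d(x, p) < r for all x ∈ K} ≤ ∫_U (1 + r κ)ⁿ dμ`. Then `θ ω ≤ ∫_U κⁿ dμ`: the ball
`{d(x₀, ·) ≤ r - R₀ - 1}` is contained in the set on the left, so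
`μ(ball)/(ω (r-R₀-1)ⁿ) ≤ ω⁻¹ ∫_U ((1 + rκ)/(r-R₀-1))ⁿ dμ → ω⁻¹ ∫_U κⁿ dμ` (dominated convergence,
dominating function `4ⁿ(1 + κⁿ)`), while the left side tends to `θ`.
[cite: Brendle2022, §2, proof of Thm. 1.1 (last paragraph)] -/
theorem volumeRatio_mul_le_setIntegral_pow_of_measure_le {X : Type*} [MeasurableSpace X]
    {μ : Measure X} {d : X → X → ℝ≥0∞} {x₀ : X} {n : ℕ} {ω θ R₀ : ℝ} {K U : Set X} {κ : X → ℝ}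
    (hω : 0 < ω) (hsymm : ∀ x y, d x y = d y x) (htri : ∀ x y z, d x z ≤ d x y + d y z)
    (hAVR : Tendsto (fun r : ℝ ↦ (μ {y | d x₀ y ≤ ENNReal.ofReal r}).toReal / (ω * r ^ n))
      atTop (𝓝 θ))
    (hR₀ : 0 ≤ R₀) (hK : ∀ x ∈ K, d x₀ x ≤ ENNReal.ofReal R₀) (hUfin : μ U ≠ ∞)
    (hκ : ∀ x, 0 ≤ κ x) (hκm : AEStronglyMeasurable κ (μ.restrict U))
    (hκi : IntegrableOn (fun x ↦ κ x ^ n) U μ)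
    (hbound : ∀ᶠ r : ℝ in atTop, μ {p | ∀ x ∈ K, d x p < ENNReal.ofReal r} ≤
      ENNReal.ofReal (∫ x in U, (1 + r * κ x) ^ n ∂μ)) :
    θ * ω ≤ ∫ x in U, κ x ^ n ∂μ := by
  set c : ℝ := R₀ + 1 with hc
  -- the two functions of `r` to compare
  set a : ℝ → ℝ := fun r ↦ (μ {y | d x₀ y ≤ ENNReal.ofReal (r - c)}).toReal / (ω * (r - c) ^ n)
    with ha
  set b : ℝ → ℝ := fun r ↦ ω⁻¹ * ∫ x in U, ((1 + r * κ x) / (r - c)) ^ n ∂μ with hb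
  -- `a → θ`
  have hsub : Tendsto (fun r : ℝ ↦ r - c) atTop atTop := by
    have := tendsto_atTop_add_const_right atTop (-c) tendsto_id
    exact this.congr fun r ↦ by simp [sub_eq_add_neg]
  have ha_lim : Tendsto a atTop (𝓝 θ) := hAVR.comp hsub
  -- `b → ω⁻¹ ∫_U κⁿ` by dominated convergence
  have hb_lim : Tendsto b atTop (𝓝 (ω⁻¹ * ∫ x in U, κ x ^ n ∂μ)) := by
    refine Tendsto.const_mul _ ?_
    refine tendsto_integral_filter_of_dominated_convergence (fun x ↦ 4 ^ n * (1 + κ x ^ n))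
      ?_ ?_ ?_ ?_
    · refine Eventually.of_forall fun r ↦ ?_
      have h1 : AEMeasurable (fun x ↦ ((1 + r * κ x) / (r - c)) ^ n) (μ.restrict U) :=
        (((hκm.aemeasurable.const_mul r).const_add 1).div_const (r - c)).pow_const n
      exact h1.aestronglyMeasurable
    · filter_upwards [eventually_ge_atTop (2 * c + 2)] with r hr
      refine Eventually.of_forall fun x ↦ ?_
      have hκx := hκ x
      have hrc : 0 < r - c := by rw [hc] at hr ⊢; linarith
      have hq0 : 0 ≤ (1 + r * κ x) / (r - c) :=
        div_nonneg (by nlinarith) hrc.le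
      have hq : (1 + r * κ x) / (r - c) ≤ 2 * (1 + κ x) := by
        rw [div_le_iff₀ hrc]
        rw [hc] at hr ⊢
        nlinarith
      rw [Real.norm_eq_abs, abs_of_nonneg (pow_nonneg hq0 n)]
      calc ((1 + r * κ x) / (r - c)) ^ n ≤ (2 * (1 + κ x)) ^ n := pow_le_pow_left₀ hq0 hq n
        _ = 2 ^ n * (1 + κ x) ^ n := mul_pow _ _ _
        _ ≤ 2 ^ n * (2 ^ n * (1 + κ x ^ n)) := by
            gcongr; exact one_add_pow_le_two_pow_mul hκx n
        _ = 4 ^ n * (1 + κ x ^ n) := by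
            rw [← mul_assoc, ← mul_pow]; norm_num
    · have hfin : IsFiniteMeasure (μ.restrict U) := ⟨by rwa [Measure.restrict_apply_univ,
        lt_top_iff_ne_top]⟩
      exact ((integrable_const (1 : ℝ)).add hκi).const_mul _
    · exact Eventually.of_forall fun x ↦ (tendsto_one_add_mul_div_sub (κ x) c).pow n
  -- `a ≤ b` eventually
  have hab : ∀ᶠ r in atTop, a r ≤ b r := by
    filter_upwards [hbound, eventually_gt_atTop c] with r hr hrc
    have hrc0 : 0 ≤ r - c := sub_nonneg.2 hrc.le
    have hr1 : 0 < r := by rw [hc] at hrc; linarith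
    -- the ball `{d(x₀, ·) ≤ r - c}` lies in `{p : ∀ x ∈ K, d x p < r}`
    have hincl :
        {y | d x₀ y ≤ ENNReal.ofReal (r - c)} ⊆ {p | ∀ x ∈ K, d x p < ENNReal.ofReal r} := by
      intro y hy x hx
      calc d x y ≤ d x x₀ + d x₀ y := htri x x₀ y
        _ ≤ ENNReal.ofReal R₀ + ENNReal.ofReal (r - c) := by
            rw [hsymm x x₀]; exact add_le_add (hK x hx) hy
        _ = ENNReal.ofReal (r - 1) := by
            rw [← ENNReal.ofReal_add hR₀ hrc0, hc]; ring_nf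
        _ < ENNReal.ofReal r := (ENNReal.ofReal_lt_ofReal_iff hr1).2 (by linarith)
    have hI0 : 0 ≤ ∫ x in U, (1 + r * κ x) ^ n ∂μ :=
      integral_nonneg fun x ↦ pow_nonneg (by nlinarith [hκ x]) n
    have hμle : (μ {y | d x₀ y ≤ ENNReal.ofReal (r - c)}).toReal ≤
        ∫ x in U, (1 + r * κ x) ^ n ∂μ :=
      ENNReal.toReal_le_of_le_ofReal hI0 ((measure_mono hincl).trans hr)
    have hpow : 0 < (r - c) ^ n := pow_pos (sub_pos.2 hrc) n
    simp only [ha, hb]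
    calc (μ {y | d x₀ y ≤ ENNReal.ofReal (r - c)}).toReal / (ω * (r - c) ^ n)
        ≤ (∫ x in U, (1 + r * κ x) ^ n ∂μ) / (ω * (r - c) ^ n) :=
          div_le_div_of_nonneg_right hμle (by positivity)
      _ = ω⁻¹ * ∫ x in U, ((1 + r * κ x) / (r - c)) ^ n ∂μ := by
          have hI : ∫ x in U, ((1 + r * κ x) / (r - c)) ^ n ∂μ
              = ((r - c) ^ n)⁻¹ * ∫ x in U, (1 + r * κ x) ^ n ∂μ := by
            rw [← integral_const_mul]
            refine integral_congr_ae (Eventually.of_forall fun x ↦ ?_)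
            show ((1 + r * κ x) / (r - c)) ^ n = ((r - c) ^ n)⁻¹ * (1 + r * κ x) ^ n
            rw [div_pow, div_eq_inv_mul]
          rw [hI, div_eq_inv_mul, mul_inv, mul_assoc]
  -- conclude
  have hθ : θ ≤ ω⁻¹ * ∫ x in U, κ x ^ n ∂μ := le_of_tendsto_of_tendsto ha_lim hb_lim hab
  calc θ * ω ≤ (ω⁻¹ * ∫ x in U, κ x ^ n ∂μ) * ω := mul_le_mul_of_nonneg_right hθ hω.le
    _ = ∫ x in U, κ x ^ n ∂μ := by field_simp

end ABPVolumeRatioLimit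

end Literature.Geometry.Riemannian
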